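import Summits.QuantumFields.BalabanUV.T4Continuum.Support.ShellMeasurePlaquetteCubicLocatedDich
import Summits.QuantumFields.BalabanUV.T4Continuum.Support.ShellMeasurePlaquetteCubicLocatedStencil

/-!
# `T4Continuum.ShellMeasurePlaquetteCubicLocatedDichEnd` — REPAIR of F-ne7cleaf02g9-1, part 3: THE PINNED (P4)
# BINDER AT THE LIVE LEVELS FOR OUR η-SCALED ACTION, RE-ASSEMBLED UNDER THE PER-BOND DICHOTOMY — S75 f2 fired on part
# 2's kernel, file 4's explicit row sum, leaf-03's stencil reach ∕ incidence count ∕ torus pin; NO global star hypothesis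
(cell `pub-balaban`, sub-cell `t4`, spine estimate NE7c (node U5b); NE7c ROUND-2 crew, unit
`b2b-balaban-t4-ne7c-formalise-leaf-02` gen 9; owner table `t4/b2b-balaban-t4-ne7c-p1/LEAVES-NE7c-P1.md` rows S65∕S77;
FINDING F-ne7cleaf02g9-1 (journal l.18166, GAPS l.27205, kernel `ShellMeasurePlaquetteStarClosure` p228731);
ADDITIVE — imports part 2 `ShellMeasurePlaquetteCubicLocatedDich` and leaf-03-g6's `ShellMeasurePlaquetteCubicLocatedStencil`
ONLY; [folklore]; 0 `def`, 0 `def … : Prop`, 0 sorry, 0 citation tags)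

HONEST FRAMING.  Finite four-torus programme, rung (B)+1 only — NOT infinite volume, NOT a mass gap, NOT the Clay
problem, NOT summit progress; (B), `BetaPertHyp`, (B^μ) are not consumed.  NE7c (`T4IndicatorShell.ShellWeightBound`)
is NOT PRINTED in [Balaban 1983–89] and NOT PROVED; «NE7c ⇐ the named binders» (trigger c3, WALL
`t4/b2b-balaban-t4-ne7c-p1/WALL-NE7c-P1.md` §2b).  ELEMENTARY assembly for OUR typed action; [Balaban1985Variational]
(97)–(98), p. 277 (1), p. 278 (5) LOCATE the shape only — the paper is under adjudication; nothing printed is asserted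
or cited as a fact; no estimate of Bałaban's at a live level is discharged; the identification of the weights, the
level-0 bonds and the block with Bałaban's `(Ω_j)`, `□^{∼4}` is node O's ([dict]).  HONEST DEPENDENCY (cell): continuum
YM on T⁴ ⇐ BetaPertH ∧ nine spine estimates (0/9 proved); BetaPertH ⇐ (D1) ∧ (D4) ∧ CAP+tail; G-an2-4 gates asym, D1
and NE2/3/4.

THE POINT.  The three vacuous ENDs of S77 files 3∕4∕5 (`prop4Hyp_pinned_ord₃_eta_levels`, `_explicit`,
`_geom`∕`_torusPin`) RE-MADE with the global star hypothesis `hst : ∀ b, plaqStar b ⊆ Pl` REPLACED by the per-bond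
dichotomy `hdich : ∀ c : ↥Λ, plaqStar c.1.1 c.1.2 ⊆ Pl ∨ wt c ≤ L_b·η` (+ `0 ≤ L_b`), i.e. «a bond whose plaquette star
is not inside `Pl` carries at most the lowest-scale weight» — B11 p. 277 (1) TYPE; every other hypothesis VERBATIM; the
stencil constant `72(d−1)‖τ‖Lc³` becomes `K∇ = (d−1)‖τ‖(72Lc³ + 48L_b·Lc²·((3d+2)d))`:
* **`prop4Hyp_pinned_ord₃_eta_levels_dich`** (S75 f2 `prop4Hyp_pinned_weighted` FIRED on part 2's kernel; row sums `≤ M`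
  displayed), **`_dich_explicit`** (file 4's `rowSum_kernel_le`: `M = (K∇·((3d+2)d) + 8κLc⁴·(4m))·e^{δ′R}`),
  **`_dich_geom`** (leaf-03: `m := 4d`, pin hypothesis from the stencil reach), **`_dich_torusPin`** (leaf-03's S69 torus
  pin: `R := 2`, no displayed pin datum left) — η-FREE, VOLUME-FREE, k-UNIFORM constants.
INHABITED: a box `Λ` (all bonds of a cube), `Pl = {p : ∂p ⊆ Λ}`, weights `η` (every bond «low», `L_b = Lc = 1`),
`U₀ = 1` — the sequel `…DichToy` files the kernel witness.  Nothing in the countdown moves; NE7c NOT PROVED; spine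
PROVED 0∕9.
-/

noncomputable section

open scoped BigOperators

namespace Summit.QuantumFields.BalabanUV.T4Continuum.ShellMeasurePlaquetteCubicLocatedDichEnd

open Literature.MathematicalPhysics.QuantumFieldTheory.Balaban1983to89
open B7Prop1Explicit (e U1 mem_U1)
open B8Ineq132 (covDerivFwd)
open B11Prop6Scheme (Prop4Hyp)
open B12Decay510Torus (pl1)
open TreeLengthTorus (TPt proj)
open ShellMeasureWilsonGradientTail (plaqWord bonds)
open ShellMeasurePlaquetteTwist (plaqFunSym)
open ShellMeasureLocalGradientTailJet (ord₃)
open Summit.QuantumFields.BalabanUV.T4Continuum.ShellMeasureCommutatorVariation (plaqStar)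
open Summit.QuantumFields.BalabanUV.T4Continuum.ShellMeasureCommutatorGradientLocal (baseSites nbhdSites)
open Summit.QuantumFields.BalabanUV.T4Continuum.ShellMeasureCommutatorLocGrad (ext)
open Summit.QuantumFields.BalabanUV.T4Continuum.ShellMeasureLocalGradientTail (locGrad)
open Summit.QuantumFields.BalabanUV.T4Continuum.ShellMeasureMultiGridNorms (WSup)
open Summit.QuantumFields.BalabanUV.T4Continuum.ShellMeasureMultiGridNormsMax (WMax)
open Summit.QuantumFields.BalabanUV.T4Continuum.ShellMeasurePinnedNorm (pinW pinDist pinDist_nonneg pinDist_le_add)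
open Summit.QuantumFields.BalabanUV.T4Continuum.ShellMeasurePinnedProp4Weighted (prop4Hyp_pinned_weighted)
open Summit.QuantumFields.BalabanUV.T4Continuum.ShellMeasureWilsonRemainderLevels (etaScale)
open Summit.QuantumFields.BalabanUV.T4Continuum.ShellMeasurePlaquetteCubicLocatedPinnedLevels
  (differentiable_locGrad_etaScale_sum_ord₃)
open Summit.QuantumFields.BalabanUV.T4Continuum.ShellMeasurePlaquetteCubicLocatedRowSum (rowSum_kernel_le)
open Summit.QuantumFields.BalabanUV.T4Continuum.ShellMeasurePlaquetteCubicLocatedStencil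
  (kernelReach_of_stencilReach card_filter_mem_bonds_le reach_torusPin_le_two)
open Summit.QuantumFields.BalabanUV.T4Continuum.ShellMeasurePlaquetteCubicLocatedDich (located_quad_ord₃_eta_levels_dich_kernel)

export B7Prop1Explicit (Site)

variable {d : ℕ} {𝔸 : Type*} [NormedRing 𝔸] [NormOneClass 𝔸] [NormedAlgebra ℂ 𝔸] [CompleteSpace 𝔸]
  (Λ : Finset (Site d × Fin d)) (Pl : Finset (Fin d × Fin d × Site d)) (τ : 𝔸 →L[ℂ] ℂ)
  {U₀ : Site d → Fin d → 𝔸ˣ} (h₀ : ∀ y κ, U₀ y κ ∈ U1 𝔸) (bd : Fin d × Fin d × Site d → (Fin 4 → ↥Λ × Bool))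
  (wt : ↥Λ → ℝ) [hwt : Fact (∀ b, 0 < wt b)] {I : Type*} [Fintype I] (wd : I → ℝ) [hwd : Fact (∀ i, 0 < wd i)]
  (Dv : (↥Λ → 𝔸) →L[ℂ] (I → 𝔸)) (Wf Wd : ↥Λ → ℝ) (W : Fin d × Fin d × Site d → ℝ)
include h₀

/-- **THE PINNED (P4) BINDER AT THE LIVE LEVELS FOR OUR η-SCALED ACTION — REPAIRED (row sums displayed).**  S77 file 3's
`prop4Hyp_pinned_ord₃_eta_levels` with `hst` REPLACED by the per-bond dichotomy `hdich` (+ `0 ≤ L_b`) and the stencil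
constant `K∇ = (d−1)‖τ‖(72Lc³ + 48L_b·Lc²·((3d+2)d))`; every other datum∕hypothesis VERBATIM (weights `wt`, `wd`, `W`,
floors `Wf`∕`Wd`, scale jump `Lc`, ∇-datum domination near the bond, `Pl` increasing with boundaries `bd p = ∂p` in `Λ`
oriented `(+,+,−,−)`, `U₀` ∈ `U1` with `‖U₀(∂p) − 1‖ ≤ ε₀(η∕W p)²`, τ tracial, `η > 0`, `0 < ε`, `4ε ≤ 1`; the pin `ρ`,
`posIn`, `posOut`, `ϖ ≥ 0` one-sided Lipschitz, `δ′ ≥ 0`; the row sums `∀ c, Σ_b k c b·e^{δ′ρ(posOut c, posIn b)} ≤ M`).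
Conclusion: `Prop4Hyp (W_pin) M (ε∕2)` for `W := locGrad (etaScale η (Σ_p ord₃ plaqFunSym_p))` from
`WMax (wt·e^{δ′ϖ∘posIn}) wd Dv` to `WSup ((wt)³·e^{δ′ϖ∘posOut}) 1 (𝔸 →L[ℂ] ℂ)`.  [Balaban1985Variational] (98) TYPE,
located and pinned; nothing printed is asserted. [folklore] -/
theorem prop4Hyp_pinned_ord₃_eta_levels_dich {η : ℝ} (hη : 0 < η) (htr : ∀ P Q : 𝔸, τ (P * Q) = τ (Q * P))
    (hincr : ∀ p ∈ Pl, p.1 < p.2.1) {Lc Lb : ℝ} (hLc : 1 ≤ Lc) (hLb : 0 ≤ Lb)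
    (hdich : ∀ c : ↥Λ, plaqStar c.1.1 c.1.2 ⊆ Pl ∨ wt c ≤ Lb * η)
    (hbd : ∀ p ∈ Pl, ((bd p 0).1 : Site d × Fin d) = (p.2.2, p.1) ∧ ((bd p 1).1 : Site d × Fin d) = (p.2.2 + e p.1, p.2.1)
      ∧ ((bd p 2).1 : Site d × Fin d) = (p.2.2 + e p.2.1, p.1) ∧ ((bd p 3).1 : Site d × Fin d) = (p.2.2, p.2.1))
    (hor : ∀ p ∈ Pl, (bd p 0).2 = true ∧ (bd p 1).2 = true ∧ (bd p 2).2 = false ∧ (bd p 3).2 = false)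
    (hWd0 : ∀ b, 0 < Wd b) (hWf : ∀ b b' : ↥Λ, b'.1.1 ∈ nbhdSites b.1.1 b.1.2 → Wf b ≤ wt b')
    (hcf : ∀ b, wt b ≤ Lc * Wf b) (hcd : ∀ b, wt b ≤ Lc * Wd b)
    (hDv : ∀ (A : ↥Λ → 𝔸) (b : ↥Λ) (x : Site d) (κ' τ' : Fin d), x ∈ baseSites b.1.1 →
      Wd b ^ 2 * ‖covDerivFwd η U₀ κ' (fun z => ext Λ A z τ') x‖ ≤ ‖(WSup.toPiL wd 2).symm (Dv A)‖)
    {ε ε₀ : ℝ} (hε : 0 < ε) (hε₀ : 0 ≤ ε₀) (hε4 : 4 * ε ≤ 1) (hηW : ∀ p ∈ Pl, η ≤ W p)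
    (hWw : ∀ p ∈ Pl, ∀ b ∈ bonds (bd p), W p ≤ wt b) (hwW : ∀ p ∈ Pl, ∀ b ∈ bonds (bd p), wt b ≤ Lc * W p)
    (hreg : ∀ p ∈ Pl, ‖(plaqWord (fun b : ↥Λ => U₀ b.1.1 b.1.2) (bd p) (0 : ↥Λ → 𝔸) : 𝔸) - 1‖ ≤ ε₀ * (η / W p) ^ 2)
    {S : Type*} (ρ : S → S → ℝ) (posIn posOut : ↥Λ → S) (ϖ : S → ℝ) {δ' M : ℝ} (hδ' : 0 ≤ δ')
    (hϖ0 : ∀ x, 0 ≤ ϖ x) (hϖ : ∀ x y, ϖ x ≤ ϖ y + ρ x y) (hM0 : 0 ≤ M)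
    (hM : ∀ c : ↥Λ, ∑ b : ↥Λ,
      (((d : ℝ) - 1) * ‖τ‖ * (72 * Lc ^ 3 + 48 * Lb * Lc ^ 2 * ((3 * d + 2) * d : ℕ)) *
          (if b.1.1 ∈ nbhdSites c.1.1 c.1.2 then 1 else 0)
        + 8 * (‖τ‖ * (248 / 3 * ε₀ + 40 / 3 * ε)) * Lc ^ 4 *
          ((Pl.filter (fun p => c ∈ bonds (bd p) ∧ b ∈ bonds (bd p))).card : ℝ))
        * Real.exp (δ' * ρ (posOut c) (posIn b)) ≤ M) :
    Prop4Hyp (fun Y : WMax (fun b => wt b * pinW δ' (ϖ ∘ posIn) b) wd Dv =>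
        ((WSup.toPiL (fun c => wt c ^ 3 * pinW δ' (ϖ ∘ posOut) c) 1).symm
          (locGrad (etaScale η (fun A : ↥Λ → 𝔸 =>
              ∑ p ∈ Pl, ord₃ (plaqFunSym τ (fun b : ↥Λ => U₀ b.1.1 b.1.2) (bd p)) A))
            (WMax.toPiL (fun b => wt b * pinW δ' (ϖ ∘ posIn) b) wd Dv Y)) :
          WSup (fun c => wt c ^ 3 * pinW δ' (ϖ ∘ posOut) c) 1 (𝔸 →L[ℂ] ℂ))) M (ε / 2) := by
  refine prop4Hyp_pinned_weighted wt wd Dv (fun c => wt c ^ 3) _ _ ρ posIn posOut ϖ hδ' hϖ0 hϖ (fun c b => ?_)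
    (fun Y hY c => located_quad_ord₃_eta_levels_dich_kernel Λ Pl τ h₀ bd wt wd Dv Wf Wd W hη htr hincr hLc hLb (hdich c)
      hbd hor (hWd0 c) (hWf c) (hcf c) (hcd c) (fun A x κ' τ' hx => hDv A c x κ' τ' hx) hε hε₀ hε4 hηW hWw hwW hreg Y hY)
    hM0 hM ((differentiable_locGrad_etaScale_sum_ord₃ Λ Pl τ h₀ bd wt wd Dv η).differentiableOn)
  -- the kernel is nonnegative
  have hd : 0 ≤ (d : ℝ) - 1 := by
    have : 1 ≤ d := Nat.succ_le_of_lt (Fin.pos c.1.2)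
    have : (1 : ℝ) ≤ d := by exact_mod_cast this
    linarith
  have hLc0 : 0 ≤ Lc := zero_le_one.trans hLc
  have h1 : 0 ≤ (if b.1.1 ∈ nbhdSites c.1.1 c.1.2 then (1 : ℝ) else 0) := by split_ifs <;> norm_num
  positivity

/-- **REPAIRED, ROW SUM EXPLICIT** (S77 file 4's `_explicit` under the dichotomy): with the incidence bound
`#{p ∈ Pl : b ∈ ∂p} ≤ m` and ONE displayed pin input «kernel-neighbours within pin-distance `R`» (and `1 ≤ d`),
`M := (K∇·((3d+2)d) + 8κLc⁴·(4m))·e^{δ′R}` — η-FREE, VOLUME-FREE. [folklore] -/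
theorem prop4Hyp_pinned_ord₃_eta_levels_dich_explicit {η : ℝ} (hη : 0 < η) (htr : ∀ P Q : 𝔸, τ (P * Q) = τ (Q * P))
    (hincr : ∀ p ∈ Pl, p.1 < p.2.1) {Lc Lb : ℝ} (hLc : 1 ≤ Lc) (hLb : 0 ≤ Lb)
    (hdich : ∀ c : ↥Λ, plaqStar c.1.1 c.1.2 ⊆ Pl ∨ wt c ≤ Lb * η)
    (hbd : ∀ p ∈ Pl, ((bd p 0).1 : Site d × Fin d) = (p.2.2, p.1) ∧ ((bd p 1).1 : Site d × Fin d) = (p.2.2 + e p.1, p.2.1)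
      ∧ ((bd p 2).1 : Site d × Fin d) = (p.2.2 + e p.2.1, p.1) ∧ ((bd p 3).1 : Site d × Fin d) = (p.2.2, p.2.1))
    (hor : ∀ p ∈ Pl, (bd p 0).2 = true ∧ (bd p 1).2 = true ∧ (bd p 2).2 = false ∧ (bd p 3).2 = false)
    (hWd0 : ∀ b, 0 < Wd b) (hWf : ∀ b b' : ↥Λ, b'.1.1 ∈ nbhdSites b.1.1 b.1.2 → Wf b ≤ wt b')
    (hcf : ∀ b, wt b ≤ Lc * Wf b) (hcd : ∀ b, wt b ≤ Lc * Wd b)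
    (hDv : ∀ (A : ↥Λ → 𝔸) (b : ↥Λ) (x : Site d) (κ' τ' : Fin d), x ∈ baseSites b.1.1 →
      Wd b ^ 2 * ‖covDerivFwd η U₀ κ' (fun z => ext Λ A z τ') x‖ ≤ ‖(WSup.toPiL wd 2).symm (Dv A)‖)
    {ε ε₀ : ℝ} (hε : 0 < ε) (hε₀ : 0 ≤ ε₀) (hε4 : 4 * ε ≤ 1) (hηW : ∀ p ∈ Pl, η ≤ W p)
    (hWw : ∀ p ∈ Pl, ∀ b ∈ bonds (bd p), W p ≤ wt b) (hwW : ∀ p ∈ Pl, ∀ b ∈ bonds (bd p), wt b ≤ Lc * W p)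
    (hreg : ∀ p ∈ Pl, ‖(plaqWord (fun b : ↥Λ => U₀ b.1.1 b.1.2) (bd p) (0 : ↥Λ → 𝔸) : 𝔸) - 1‖ ≤ ε₀ * (η / W p) ^ 2)
    {m : ℕ} (hm : ∀ b : ↥Λ, (Pl.filter (fun p => b ∈ bonds (bd p))).card ≤ m) (hd1 : 1 ≤ d)
    {S : Type*} (ρ : S → S → ℝ) (posIn posOut : ↥Λ → S) (ϖ : S → ℝ) {δ' R : ℝ} (hδ' : 0 ≤ δ')
    (hϖ0 : ∀ x, 0 ≤ ϖ x) (hϖ : ∀ x y, ϖ x ≤ ϖ y + ρ x y)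
    (hR : ∀ c b : ↥Λ, (b.1.1 ∈ nbhdSites c.1.1 c.1.2 ∨ ∃ p ∈ Pl, c ∈ bonds (bd p) ∧ b ∈ bonds (bd p)) →
      ρ (posOut c) (posIn b) ≤ R) :
    Prop4Hyp (fun Y : WMax (fun b => wt b * pinW δ' (ϖ ∘ posIn) b) wd Dv =>
        ((WSup.toPiL (fun c => wt c ^ 3 * pinW δ' (ϖ ∘ posOut) c) 1).symm
          (locGrad (etaScale η (fun A : ↥Λ → 𝔸 =>
              ∑ p ∈ Pl, ord₃ (plaqFunSym τ (fun b : ↥Λ => U₀ b.1.1 b.1.2) (bd p)) A))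
            (WMax.toPiL (fun b => wt b * pinW δ' (ϖ ∘ posIn) b) wd Dv Y)) :
          WSup (fun c => wt c ^ 3 * pinW δ' (ϖ ∘ posOut) c) 1 (𝔸 →L[ℂ] ℂ)))
      ((((d : ℝ) - 1) * ‖τ‖ * (72 * Lc ^ 3 + 48 * Lb * Lc ^ 2 * ((3 * d + 2) * d : ℕ)) * ((3 * d + 2) * d : ℕ)
          + 8 * (‖τ‖ * (248 / 3 * ε₀ + 40 / 3 * ε)) * Lc ^ 4 * (4 * m)) * Real.exp (δ' * R))
      (ε / 2) := by
  have hd : 0 ≤ (d : ℝ) - 1 := by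
    have : (1 : ℝ) ≤ d := by exact_mod_cast hd1
    linarith
  have hLc0 : 0 ≤ Lc := zero_le_one.trans hLc
  have hK₁ : 0 ≤ ((d : ℝ) - 1) * ‖τ‖ * (72 * Lc ^ 3 + 48 * Lb * Lc ^ 2 * ((3 * d + 2) * d : ℕ)) := by positivity
  have hK₂ : 0 ≤ 8 * (‖τ‖ * (248 / 3 * ε₀ + 40 / 3 * ε)) * Lc ^ 4 := by positivity
  have hM0 : 0 ≤ (((d : ℝ) - 1) * ‖τ‖ * (72 * Lc ^ 3 + 48 * Lb * Lc ^ 2 * ((3 * d + 2) * d : ℕ)) * ((3 * d + 2) * d : ℕ)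
      + 8 * (‖τ‖ * (248 / 3 * ε₀ + 40 / 3 * ε)) * Lc ^ 4 * (4 * m)) * Real.exp (δ' * R) := by positivity
  exact prop4Hyp_pinned_ord₃_eta_levels_dich Λ Pl τ h₀ bd wt wd Dv Wf Wd W hη htr hincr hLc hLb hdich hbd hor hWd0 hWf
    hcf hcd hDv hε hε₀ hε4 hηW hWw hwW hreg ρ posIn posOut ϖ hδ' hϖ0 hϖ hM0
    (fun c => rowSum_kernel_le Λ Pl bd ρ posIn posOut hδ' hK₁ hK₂ hm c (hR c))

/-- **REPAIRED, GEOMETRIC** (leaf-03-g6's `_geom` under the dichotomy): the incidence count DISCHARGED (`m := 4d`,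
`card_filter_mem_bonds_le`) and the pin hypothesis from the STENCIL-ONLY reach
`hreach : b.1.1 ∈ nbhdSites c.1.1 c.1.2 → ρ (posOut c) (posIn b) ≤ R` (`kernelReach_of_stencilReach`).
Constant `(K∇·((3d+2)d) + 8κLc⁴·(4·4d))·e^{δ′R}`. [folklore] -/
theorem prop4Hyp_pinned_ord₃_eta_levels_dich_geom {η : ℝ} (hη : 0 < η) (htr : ∀ P Q : 𝔸, τ (P * Q) = τ (Q * P))
    (hincr : ∀ p ∈ Pl, p.1 < p.2.1) {Lc Lb : ℝ} (hLc : 1 ≤ Lc) (hLb : 0 ≤ Lb)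
    (hdich : ∀ c : ↥Λ, plaqStar c.1.1 c.1.2 ⊆ Pl ∨ wt c ≤ Lb * η)
    (hbd : ∀ p ∈ Pl, ((bd p 0).1 : Site d × Fin d) = (p.2.2, p.1) ∧ ((bd p 1).1 : Site d × Fin d) = (p.2.2 + e p.1, p.2.1)
      ∧ ((bd p 2).1 : Site d × Fin d) = (p.2.2 + e p.2.1, p.1) ∧ ((bd p 3).1 : Site d × Fin d) = (p.2.2, p.2.1))
    (hor : ∀ p ∈ Pl, (bd p 0).2 = true ∧ (bd p 1).2 = true ∧ (bd p 2).2 = false ∧ (bd p 3).2 = false)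
    (hWd0 : ∀ b, 0 < Wd b) (hWf : ∀ b b' : ↥Λ, b'.1.1 ∈ nbhdSites b.1.1 b.1.2 → Wf b ≤ wt b')
    (hcf : ∀ b, wt b ≤ Lc * Wf b) (hcd : ∀ b, wt b ≤ Lc * Wd b)
    (hDv : ∀ (A : ↥Λ → 𝔸) (b : ↥Λ) (x : Site d) (κ' τ' : Fin d), x ∈ baseSites b.1.1 →
      Wd b ^ 2 * ‖covDerivFwd η U₀ κ' (fun z => ext Λ A z τ') x‖ ≤ ‖(WSup.toPiL wd 2).symm (Dv A)‖)
    {ε ε₀ : ℝ} (hε : 0 < ε) (hε₀ : 0 ≤ ε₀) (hε4 : 4 * ε ≤ 1) (hηW : ∀ p ∈ Pl, η ≤ W p)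
    (hWw : ∀ p ∈ Pl, ∀ b ∈ bonds (bd p), W p ≤ wt b) (hwW : ∀ p ∈ Pl, ∀ b ∈ bonds (bd p), wt b ≤ Lc * W p)
    (hreg : ∀ p ∈ Pl, ‖(plaqWord (fun b : ↥Λ => U₀ b.1.1 b.1.2) (bd p) (0 : ↥Λ → 𝔸) : 𝔸) - 1‖ ≤ ε₀ * (η / W p) ^ 2)
    (hd1 : 1 ≤ d) {S : Type*} (ρ : S → S → ℝ) (posIn posOut : ↥Λ → S) (ϖ : S → ℝ) {δ' R : ℝ} (hδ' : 0 ≤ δ')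
    (hϖ0 : ∀ x, 0 ≤ ϖ x) (hϖ : ∀ x y, ϖ x ≤ ϖ y + ρ x y)
    (hreach : ∀ c b : ↥Λ, b.1.1 ∈ nbhdSites c.1.1 c.1.2 → ρ (posOut c) (posIn b) ≤ R) :
    Prop4Hyp (fun Y : WMax (fun b => wt b * pinW δ' (ϖ ∘ posIn) b) wd Dv =>
        ((WSup.toPiL (fun c => wt c ^ 3 * pinW δ' (ϖ ∘ posOut) c) 1).symm
          (locGrad (etaScale η (fun A : ↥Λ → 𝔸 =>
              ∑ p ∈ Pl, ord₃ (plaqFunSym τ (fun b : ↥Λ => U₀ b.1.1 b.1.2) (bd p)) A))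
            (WMax.toPiL (fun b => wt b * pinW δ' (ϖ ∘ posIn) b) wd Dv Y)) :
          WSup (fun c => wt c ^ 3 * pinW δ' (ϖ ∘ posOut) c) 1 (𝔸 →L[ℂ] ℂ)))
      ((((d : ℝ) - 1) * ‖τ‖ * (72 * Lc ^ 3 + 48 * Lb * Lc ^ 2 * ((3 * d + 2) * d : ℕ)) * ((3 * d + 2) * d : ℕ)
          + 8 * (‖τ‖ * (248 / 3 * ε₀ + 40 / 3 * ε)) * Lc ^ 4 * (4 * (4 * d : ℕ))) * Real.exp (δ' * R))
      (ε / 2) :=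
  prop4Hyp_pinned_ord₃_eta_levels_dich_explicit Λ Pl τ h₀ bd wt wd Dv Wf Wd W hη htr hincr hLc hLb hdich hbd hor hWd0 hWf
    hcf hcd hDv hε hε₀ hε4 hηW hWw hwW hreg (card_filter_mem_bonds_le Pl hbd) hd1 ρ posIn posOut ϖ hδ' hϖ0 hϖ
    (kernelReach_of_stencilReach Pl hbd ρ posIn posOut hreach)

/-- **REPAIRED, THE CONCRETE TORUS PIN** (leaf-03-g6's `_torusPin` under the dichotomy): S69's `pinDist B₀ hB₀` of a
nonempty site set `B₀ ⊆ (ℤ∕T)ᵈ` read at the bonds' base sites `proj T b.1.1`, periodic ℓ¹ distance, rate `δ′ ≥ 0`,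
reach `2`; NO displayed pin datum left.  Constant `(K∇·((3d+2)d) + 8κLc⁴·16d)·e^{2δ′}`. [folklore] -/
theorem prop4Hyp_pinned_ord₃_eta_levels_dich_torusPin {η : ℝ} (hη : 0 < η) (htr : ∀ P Q : 𝔸, τ (P * Q) = τ (Q * P))
    (hincr : ∀ p ∈ Pl, p.1 < p.2.1) {Lc Lb : ℝ} (hLc : 1 ≤ Lc) (hLb : 0 ≤ Lb)
    (hdich : ∀ c : ↥Λ, plaqStar c.1.1 c.1.2 ⊆ Pl ∨ wt c ≤ Lb * η)
    (hbd : ∀ p ∈ Pl, ((bd p 0).1 : Site d × Fin d) = (p.2.2, p.1) ∧ ((bd p 1).1 : Site d × Fin d) = (p.2.2 + e p.1, p.2.1)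
      ∧ ((bd p 2).1 : Site d × Fin d) = (p.2.2 + e p.2.1, p.1) ∧ ((bd p 3).1 : Site d × Fin d) = (p.2.2, p.2.1))
    (hor : ∀ p ∈ Pl, (bd p 0).2 = true ∧ (bd p 1).2 = true ∧ (bd p 2).2 = false ∧ (bd p 3).2 = false)
    (hWd0 : ∀ b, 0 < Wd b) (hWf : ∀ b b' : ↥Λ, b'.1.1 ∈ nbhdSites b.1.1 b.1.2 → Wf b ≤ wt b')
    (hcf : ∀ b, wt b ≤ Lc * Wf b) (hcd : ∀ b, wt b ≤ Lc * Wd b)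
    (hDv : ∀ (A : ↥Λ → 𝔸) (b : ↥Λ) (x : Site d) (κ' τ' : Fin d), x ∈ baseSites b.1.1 →
      Wd b ^ 2 * ‖covDerivFwd η U₀ κ' (fun z => ext Λ A z τ') x‖ ≤ ‖(WSup.toPiL wd 2).symm (Dv A)‖)
    {ε ε₀ : ℝ} (hε : 0 < ε) (hε₀ : 0 ≤ ε₀) (hε4 : 4 * ε ≤ 1) (hηW : ∀ p ∈ Pl, η ≤ W p)
    (hWw : ∀ p ∈ Pl, ∀ b ∈ bonds (bd p), W p ≤ wt b) (hwW : ∀ p ∈ Pl, ∀ b ∈ bonds (bd p), wt b ≤ Lc * W p)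
    (hreg : ∀ p ∈ Pl, ‖(plaqWord (fun b : ↥Λ => U₀ b.1.1 b.1.2) (bd p) (0 : ↥Λ → 𝔸) : 𝔸) - 1‖ ≤ ε₀ * (η / W p) ^ 2)
    (hd1 : 1 ≤ d) {T : ℕ} [NeZero T] (B₀ : Finset (TPt d T)) (hB₀ : B₀.Nonempty) {δ' : ℝ} (hδ' : 0 ≤ δ') :
    Prop4Hyp (fun Y : WMax (fun b => wt b * pinW δ' (pinDist B₀ hB₀ ∘ fun b : ↥Λ => proj T b.1.1) b) wd Dv =>
        ((WSup.toPiL (fun c => wt c ^ 3 * pinW δ' (pinDist B₀ hB₀ ∘ fun b : ↥Λ => proj T b.1.1) c) 1).symm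
          (locGrad (etaScale η (fun A : ↥Λ → 𝔸 =>
              ∑ p ∈ Pl, ord₃ (plaqFunSym τ (fun b : ↥Λ => U₀ b.1.1 b.1.2) (bd p)) A))
            (WMax.toPiL (fun b => wt b * pinW δ' (pinDist B₀ hB₀ ∘ fun b : ↥Λ => proj T b.1.1) b) wd Dv Y)) :
          WSup (fun c => wt c ^ 3 * pinW δ' (pinDist B₀ hB₀ ∘ fun b : ↥Λ => proj T b.1.1) c) 1 (𝔸 →L[ℂ] ℂ)))
      ((((d : ℝ) - 1) * ‖τ‖ * (72 * Lc ^ 3 + 48 * Lb * Lc ^ 2 * ((3 * d + 2) * d : ℕ)) * ((3 * d + 2) * d : ℕ)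
          + 8 * (‖τ‖ * (248 / 3 * ε₀ + 40 / 3 * ε)) * Lc ^ 4 * (4 * (4 * d : ℕ))) * Real.exp (δ' * 2))
      (ε / 2) :=
  prop4Hyp_pinned_ord₃_eta_levels_dich_geom Λ Pl τ h₀ bd wt wd Dv Wf Wd W hη htr hincr hLc hLb hdich hbd hor hWd0 hWf hcf
    hcd hDv hε hε₀ hε4 hηW hWw hwW hreg hd1 (fun x y : TPt d T => pl1 (x - y)) (fun b : ↥Λ => proj T b.1.1)
    (fun b : ↥Λ => proj T b.1.1) (pinDist B₀ hB₀) hδ' (pinDist_nonneg B₀ hB₀) (pinDist_le_add B₀ hB₀)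
    (fun c b hb => reach_torusPin_le_two T c b hb)

end Summit.QuantumFields.BalabanUV.T4Continuum.ShellMeasurePlaquetteCubicLocatedDichEnd

end
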